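import Literature.LinearAlgebra.Matrix.GramDeterminantKernel
import HarnessLib

/-!
# Fine-weight admissibility, part 6: the vacuum vector of the Gram kernel (linear algebra)
(crux stmt-QuantumFields-18031 `HeatSlicedQuarks.InterleavedFlowProper`, line `Sketch`,
stub `stub_fineWeightAdmissible`, clause (2) — positivity of the signed partition function)

Pure linear algebra behind the strict positivity `0 < ∫ exp(-β S_W) ∏_f det D_AP` on the odd
torus. In the Cauchy–Binet Gram expansion `det (1 + P'ᴴ Y P) = ∑_{q' q} Ψ_{q'}(P) Q_{q' q} conj Ψ_q(P')`
(`Literature.LinearAlgebra.Matrix.det_one_add_eq_sum_gram` at `Y₀ = 1`; indices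
`q : σ → σ ⊕ σ` = row selections of the stacked matrix `[1; P]`) the "vacuum" vector
`v_q = ∑_τ [q = inl ∘ τ] sign τ` (the antisymmetrised selection of the rows of the identity block)
satisfies

* `∑_q v_q Ψ_q(P) = |σ|!` for EVERY `P` (`sum_signVec_mul_gramFeature`): the vacuum component of
  the feature vector is a positive constant;
* `∑_q Q_{q' q} v_q = (|σ|!)⁻¹ v_{q'}` for the coupling `Q = gramCoupling 1 Y` of EVERY `Y`
  (`sum_gramCoupling_one_mul_signVec`): `v` is an eigenvector of the (positive semidefinite)
  coupling with a positive eigenvalue;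

and for a positive semidefinite Hermitian form with an eigenvector `V` of eigenvalue `λ ≥ 0`, the
form dominates the rank-one form `(λ/‖V‖²) |⟨V, ·⟩|²` (`sum_mul_conj_mul_sub_rankOne_nonneg`).
Feeding the difference kernel to the odd-torus reflection-positivity mechanism bounds the
partition function from below by the integral of a pointwise positive function (part 7).
All statements are proved; no definitions (the vector `v` is written out).
-/

noncomputable section

namespace Summit.QuantumFields.QCD.Cruxes.InterleavedFlowProper.OffsetLastFormatHandover

namespace FineWeight

open Matrix Complex Finset Literature.LinearAlgebra.Matrix
open scoped ComplexOrder ComplexConjugate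

/-! ## A positive semidefinite form dominates the rank-one form of an eigenvector -/

section RankOne

variable {𝓘 : Type*} [Fintype 𝓘]

/-- For a positive semidefinite `M` with `M V = λ V`: `⟨u, M u⟩ - (λ/⟨V, V⟩) |⟨V, u⟩|² = ⟨w, M w⟩ ≥ 0`
with `w = u - (⟨V,u⟩/⟨V,V⟩) V`. -/
theorem dotProduct_mulVec_sub_rankOne_nonneg {M : Matrix 𝓘 𝓘 ℂ} (hM : M.PosSemidef) {V : 𝓘 → ℂ} {lam : ℝ}
    (hV : M *ᵥ V = (lam : ℂ) • V) (u : 𝓘 → ℂ) :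
    0 ≤ star u ⬝ᵥ (M *ᵥ u) - (lam : ℂ) / (star V ⬝ᵥ V) * (star (star V ⬝ᵥ u) * (star V ⬝ᵥ u)) := by
  have hPSD := Matrix.posSemidef_iff_dotProduct_mulVec.mp hM
  by_cases hν : star V ⬝ᵥ V = 0
  · rw [hν, div_zero, zero_mul, sub_zero]
    exact hPSD.2 u
  -- `⟨V, M x⟩ = λ ⟨V, x⟩` (Hermitian, real eigenvalue)
  have hVM : ∀ x : 𝓘 → ℂ, star V ⬝ᵥ (M *ᵥ x) = (lam : ℂ) * (star V ⬝ᵥ x) := fun x => by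
    rw [Matrix.dotProduct_mulVec, show star V ᵥ* M = star (Mᴴ *ᵥ V) by rw [Matrix.star_mulVec, Matrix.conjTranspose_conjTranspose],
      hM.1.eq, hV, star_smul, Complex.star_def, Complex.conj_ofReal, smul_dotProduct, smul_eq_mul]
  have hMV : ∀ x : 𝓘 → ℂ, star x ⬝ᵥ (M *ᵥ V) = (lam : ℂ) * (star x ⬝ᵥ V) := fun x => by
    rw [hV, dotProduct_smul, smul_eq_mul]
  set ν : ℂ := star V ⬝ᵥ V with hνdef
  set a : ℂ := star V ⬝ᵥ u with ha
  have hb : star u ⬝ᵥ V = star a := star_dotProduct u V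
  have hνs : star ν = ν := (star_dotProduct V V).symm
  set α : ℂ := a / ν with hα
  set w : 𝓘 → ℂ := u - α • V with hw
  have hexp : star w ⬝ᵥ (M *ᵥ w) = star u ⬝ᵥ (M *ᵥ u) - (lam : ℂ) / ν * (star a * a) := by
    simp only [hw, Matrix.mulVec_sub, Matrix.mulVec_smul, star_sub, star_smul, sub_dotProduct, dotProduct_sub,
      smul_dotProduct, dotProduct_smul, smul_eq_mul, hVM, hMV, hb, ← ha, ← hνdef]
    simp only [hα, star_div₀, hνs]
    field_simp
    ring
  rw [← hexp]
  exact hPSD.2 w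

/-- Sum form: for positive semidefinite `M` with `M V = λ V`, the Hermitian form of the kernel
`M_{IJ} - (λ/⟨V,V⟩) V_I conj V_J` is non-negative. -/
theorem sum_mul_conj_mul_sub_rankOne_nonneg {M : Matrix 𝓘 𝓘 ℂ} (hM : M.PosSemidef) {V : 𝓘 → ℂ} {lam : ℝ}
    (hV : M *ᵥ V = (lam : ℂ) • V) (x : 𝓘 → ℂ) :
    0 ≤ ∑ I, ∑ J, x I * conj (x J) * (M I J - (lam : ℂ) / (star V ⬝ᵥ V) * (V I * conj (V J))) := by
  have h := dotProduct_mulVec_sub_rankOne_nonneg hM hV (fun J => conj (x J))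
  convert h using 1
  have h1 : star V ⬝ᵥ (fun J => conj (x J)) = conj (∑ I, V I * x I) := by
    simp only [dotProduct, Pi.star_apply, RCLike.star_def, map_sum, map_mul]
  simp only [dotProduct, Matrix.mulVec, Pi.star_apply, RCLike.star_def, Complex.conj_conj, Finset.mul_sum,
    mul_sub, Finset.sum_sub_distrib] at h1 ⊢
  rw [h1]
  simp only [map_sum, map_mul, Complex.conj_conj, Finset.mul_sum, Finset.sum_mul]
  congr 1
  · exact Finset.sum_congr rfl fun I _ => Finset.sum_congr rfl fun J _ => by ring
  · rw [Finset.sum_comm]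
    exact Finset.sum_congr rfl fun I _ => Finset.sum_congr rfl fun J _ => by ring

end RankOne

/-! ## The vacuum vector of the Cauchy–Binet Gram expansion -/

section Vacuum

variable {σ : Type*} [Fintype σ] [DecidableEq σ]

omit [Fintype σ] [DecidableEq σ] in
/-- `inl ∘ τ = inl ∘ τ'` iff `τ = τ'`. -/
theorem inl_comp_perm_inj {τ τ' : Equiv.Perm σ} :
    (Sum.inl ∘ ⇑τ : σ → σ ⊕ σ) = Sum.inl ∘ ⇑τ' ↔ τ = τ' := by
  refine ⟨fun h => Equiv.ext fun i => Sum.inl_injective (congrFun h i), fun h => by rw [h]⟩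

/-- **The vacuum component of the Gram feature is `sign τ`**: selecting the rows of the identity
block in the order `τ` gives `Ψ_{inl ∘ τ}(P) = sign τ` for every `P`. -/
theorem gramFeature_inl_comp_perm (P : Matrix σ σ ℂ) (τ : Equiv.Perm σ) :
    gramFeature P (Sum.inl ∘ ⇑τ) = ((Equiv.Perm.sign τ : ℤ) : ℂ) := by
  unfold gramFeature
  have h : (Matrix.fromRows (1 : Matrix σ σ ℂ) P).submatrix (Sum.inl ∘ ⇑τ) id = (1 : Matrix σ σ ℂ).submatrix ⇑τ id := by
    ext i j
    rfl
  rw [h, Matrix.det_permute, Matrix.det_one, mul_one]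

/-- `sign τ · sign τ = 1` in `ℂ`. -/
theorem sign_mul_sign_self (τ : Equiv.Perm σ) :
    ((Equiv.Perm.sign τ : ℤ) : ℂ) * ((Equiv.Perm.sign τ : ℤ) : ℂ) = 1 := by
  rw [← Int.cast_mul, ← Units.val_mul, Int.units_mul_self, Units.val_one, Int.cast_one]

/-- **`∑_q v_q Ψ_q(P) = |σ|!`** for the vacuum vector `v_q = ∑_τ [q = inl ∘ τ] sign τ`, every `P`. -/
theorem sum_signVec_mul_gramFeature (P : Matrix σ σ ℂ) :
    ∑ q : σ → σ ⊕ σ, (∑ τ : Equiv.Perm σ, if q = Sum.inl ∘ ⇑τ then ((Equiv.Perm.sign τ : ℤ) : ℂ) else 0) *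
      gramFeature P q = ((Fintype.card σ).factorial : ℂ) := by
  simp only [Finset.sum_mul, ite_mul, zero_mul]
  rw [Finset.sum_comm]
  simp only [Finset.sum_ite_eq', Finset.mem_univ, ↓reduceIte, gramFeature_inl_comp_perm, sign_mul_sign_self,
    Finset.sum_const, Finset.card_univ, Fintype.card_perm, nsmul_eq_mul, mul_one]

/-- The vacuum vector at the identity selection: `v_{inl} = 1` (so `v ≠ 0`). -/
theorem signVec_inl :
    (∑ τ : Equiv.Perm σ, if (Sum.inl : σ → σ ⊕ σ) = Sum.inl ∘ ⇑τ then ((Equiv.Perm.sign τ : ℤ) : ℂ) else 0) = 1 := by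
  rw [Finset.sum_eq_single (1 : Equiv.Perm σ)]
  · simp
  · intro τ _ hτ
    rw [if_neg]
    intro h
    have h1 : (Sum.inl ∘ ⇑τ : σ → σ ⊕ σ) = Sum.inl ∘ ⇑(1 : Equiv.Perm σ) := by
      rw [Equiv.Perm.coe_one]
      exact h.symm
    exact hτ (inl_comp_perm_inj.1 h1)
  · simp

/-- **Minors of `diag(1, Y)` on the rows of the identity block**: for `q' : σ → σ ⊕ σ`,
`det (diag(1, Y)[inl ∘ τ, q']) = sign τ · sign τ'` if `q' = inl ∘ τ'`, and `0` if `q'` is not of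
this form (a zero column, or two equal columns). -/
theorem det_fromBlocks_one_submatrix_inl_perm (Y : Matrix σ σ ℂ) (τ : Equiv.Perm σ) (q' : σ → σ ⊕ σ) :
    ((Matrix.fromBlocks (1 : Matrix σ σ ℂ) 0 0 Y).submatrix (Sum.inl ∘ ⇑τ) q').det =
      ∑ τ' : Equiv.Perm σ, if q' = Sum.inl ∘ ⇑τ' then ((Equiv.Perm.sign τ : ℤ) : ℂ) * ((Equiv.Perm.sign τ' : ℤ) : ℂ) else 0 := by
  by_cases h : ∃ τ' : Equiv.Perm σ, q' = Sum.inl ∘ ⇑τ'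
  · obtain ⟨τ', rfl⟩ := h
    rw [Finset.sum_eq_single τ' (fun τ'' _ h'' => if_neg (fun h => h'' (inl_comp_perm_inj.1 h).symm))
      (fun h => absurd (Finset.mem_univ _) h), if_pos rfl]
    have hsub : (Matrix.fromBlocks (1 : Matrix σ σ ℂ) 0 0 Y).submatrix (Sum.inl ∘ ⇑τ) (Sum.inl ∘ ⇑τ') =
        (1 : Matrix σ σ ℂ).submatrix id ⇑(τ⁻¹ * τ') := by
      ext i j
      simp only [Matrix.submatrix_apply, Function.comp_apply, Matrix.fromBlocks_apply₁₁, id_eq, Matrix.one_apply,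
        Equiv.Perm.coe_mul]
      congr 1
      exact propext ⟨fun h => by rw [← h, Equiv.Perm.inv_def, Equiv.symm_apply_apply], fun h => by rw [h, Equiv.Perm.inv_def, Equiv.apply_symm_apply]⟩
    rw [hsub, Matrix.det_permute', Matrix.det_one, mul_one, map_mul, Equiv.Perm.sign_inv, Units.val_mul, Int.cast_mul]
  · rw [Finset.sum_eq_zero fun τ' _ => if_neg fun h' => h ⟨τ', h'⟩]
    by_cases hr : ∃ j b, q' j = Sum.inr b
    · obtain ⟨j, b, hj⟩ := hr
      exact Matrix.det_eq_zero_of_column_eq_zero j fun i => by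
        simp only [Matrix.submatrix_apply, Function.comp_apply, hj, Matrix.fromBlocks_apply₁₂, Matrix.zero_apply]
    · push Not at hr
      have hg : ∀ j, ∃ a, q' j = Sum.inl a := fun j => by
        cases hq : q' j with
        | inl a => exact ⟨a, rfl⟩
        | inr b => exact absurd hq (hr j b)
      choose g hg using hg
      have hq' : q' = Sum.inl ∘ g := funext hg
      have hng : ¬ Function.Injective g := fun hinj => h ⟨Equiv.ofBijective g
        (Finite.injective_iff_bijective.1 hinj), by rw [hq']; rfl⟩
      obtain ⟨j₁, j₂, hg12, hne⟩ : ∃ j₁ j₂, g j₁ = g j₂ ∧ j₁ ≠ j₂ := by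
        simpa [Function.Injective] using hng
      exact Matrix.det_zero_of_column_eq hne fun i => by
        simp only [Matrix.submatrix_apply, Function.comp_apply, hg j₁, hg j₂, Matrix.fromBlocks_apply₁₁, hg12]

/-- **The vacuum vector is an eigenvector of the Cauchy–Binet minors of `diag(1, Y)`**:
`∑_q det (diag(1,Y)[q, q']) v_q = |σ|! · v_{q'}`. -/
theorem sum_det_submatrix_mul_signVec (Y : Matrix σ σ ℂ) (q' : σ → σ ⊕ σ) :
    ∑ q : σ → σ ⊕ σ, ((Matrix.fromBlocks (1 : Matrix σ σ ℂ) 0 0 Y).submatrix q q').det *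
        (∑ τ : Equiv.Perm σ, if q = Sum.inl ∘ ⇑τ then ((Equiv.Perm.sign τ : ℤ) : ℂ) else 0) =
      ((Fintype.card σ).factorial : ℂ) *
        ∑ τ' : Equiv.Perm σ, if q' = Sum.inl ∘ ⇑τ' then ((Equiv.Perm.sign τ' : ℤ) : ℂ) else 0 := by
  simp only [Finset.mul_sum, mul_ite, mul_zero]
  rw [Finset.sum_comm]
  simp only [Finset.sum_ite_eq', Finset.mem_univ, ↓reduceIte, det_fromBlocks_one_submatrix_inl_perm]
  simp only [Finset.sum_mul, ite_mul, zero_mul]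
  rw [Finset.sum_comm]
  refine Finset.sum_congr rfl fun τ' _ => ?_
  split_ifs
  · have h1 : ∀ τ : Equiv.Perm σ, ((Equiv.Perm.sign τ : ℤ) : ℂ) * ((Equiv.Perm.sign τ' : ℤ) : ℂ) *
        ((Equiv.Perm.sign τ : ℤ) : ℂ) = ((Equiv.Perm.sign τ' : ℤ) : ℂ) := fun τ => by
      rw [mul_comm, ← mul_assoc, sign_mul_sign_self, one_mul]
    simp only [h1, Finset.sum_const, Finset.card_univ, Fintype.card_perm, nsmul_eq_mul]
  · simp

/-- **The vacuum vector is an eigenvector of the coupling `gramCoupling 1 Y`** with eigenvalue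
`(|σ|!)⁻¹`, for every `Y`: `∑_q Q_{q' q} v_q = (|σ|!)⁻¹ v_{q'}`. -/
theorem sum_gramCoupling_one_mul_signVec (Y : Matrix σ σ ℂ) (q' : σ → σ ⊕ σ) :
    ∑ q : σ → σ ⊕ σ, gramCoupling 1 Y q' q *
        (∑ τ : Equiv.Perm σ, if q = Sum.inl ∘ ⇑τ then ((Equiv.Perm.sign τ : ℤ) : ℂ) else 0) =
      ((Fintype.card σ).factorial : ℂ)⁻¹ *
        ∑ τ' : Equiv.Perm σ, if q' = Sum.inl ∘ ⇑τ' then ((Equiv.Perm.sign τ' : ℤ) : ℂ) else 0 := by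
  have hfact : ((Fintype.card σ).factorial : ℂ) ≠ 0 := Nat.cast_ne_zero.2 (Nat.factorial_ne_zero _)
  simp only [gramCoupling, Matrix.of_apply, Matrix.det_one, one_mul, inv_one, mul_assoc, ← Finset.mul_sum]
  rw [sum_det_submatrix_mul_signVec]
  field_simp

end Vacuum

section Registered

/-- **Registered sub-goal `stubFW_vacuum` of `stub_fineWeightAdmissible`** (clause (2), the
algebraic core of the strict positivity of the signed partition function): the antisymmetrised
identity-block selection is an eigenvector of the Cauchy–Binet coupling `gramCoupling 1 Y` with
eigenvalue `(|σ|!)⁻¹`, for every `Y`. -/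
theorem stubFW_vacuum : ∀ (σ : Type) [Fintype σ] [DecidableEq σ] (Y : Matrix σ σ ℂ) (q' : σ → σ ⊕ σ),
    ∑ q : σ → σ ⊕ σ, gramCoupling 1 Y q' q *
        (∑ τ : Equiv.Perm σ, if q = Sum.inl ∘ ⇑τ then ((Equiv.Perm.sign τ : ℤ) : ℂ) else 0) =
      ((Fintype.card σ).factorial : ℂ)⁻¹ *
        ∑ τ' : Equiv.Perm σ, if q' = Sum.inl ∘ ⇑τ' then ((Equiv.Perm.sign τ' : ℤ) : ℂ) else 0 :=
  fun _ _ _ Y q' => sum_gramCoupling_one_mul_signVec Y q'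

end Registered

end FineWeight

end Summit.QuantumFields.QCD.Cruxes.InterleavedFlowProper.OffsetLastFormatHandover

end
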